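import Summits.HodgeConjecture.CorCM.AbelianTwoGroupInvolutionLemmas
import Mathlib.GroupTheory.SpecificGroups.Cyclic
import HarnessLib

/-!
# Abelian `2`-groups with few involutions are thin: the marked involution lies in a large cyclic subgroup

COR-CM (cell `pub-hodgecm2`), binder seat b04 (gen 16), count-neutral claim ABELIAN-2POWER-NECESSITY, part IIIa′.
KERNEL ONLY: theorems (pure group theory, Mathlib only); no definition, no named fact, no `sorry`.

* `isAddCyclic_of_card_filter_two_nsmul_le_two` — a finite abelian group of `2`-power order with at most two
  solutions of `2x = 0` is cyclic (the `2^j`-torsion has at most `2^j` elements by induction along doubling, whence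
  Mathlib's criterion `isAddCyclic_of_card_nsmul_eq_zero_le`).
* `exists_generator_of_thin` — the THIN CASE of the atom-embedding theorem (part IIIb): if `|A| = 2^{n+1}`, the
  marked involution `c` is a double (`c = 2u`), the only involutions among the doubles are `0` and `c`, and `A` has at
  most `4` solutions of `2x = 0`, then `2A` is cyclic, generated by some `2z`, `c` is a multiple of `z`, and
  `|A| ≤ 2 · ord(z)` — i.e. `c` lies in the cyclic subgroup `⟨z⟩` of index `≤ 2` ("thin kernels", the hypothesis of
  gen 15's `ThinKernel.isNondegenerate_of_isPrimitive_of_mem_zpowers`).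

## References

* [Dodson1984] B. Dodson, *The structure of Galois groups of CM-fields*, Trans. AMS 283 (1984), §3.
-/

namespace Summit.HodgeConjecture.CorCM.TwoGroupPieces

open scoped Classical

/-! ## Few involutions ⟹ cyclic -/

section Cyclic

variable {B : Type*} [AddCommGroup B] [Fintype B] [DecidableEq B]

/-- The `2^j`-torsion of an abelian group with at most two solutions of `2x = 0` has at most `2^j` elements
(induction on `j` along the doubling map, whose fibres have at most `2` points). [folklore] -/
theorem card_filter_pow_nsmul_le (h2 : (Finset.univ.filter fun b : B => 2 • b = 0).card ≤ 2) (j : ℕ) :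
    (Finset.univ.filter fun b : B => 2 ^ j • b = 0).card ≤ 2 ^ j := by
  induction j with
  | zero =>
    rw [pow_zero]
    refine Finset.card_le_one.2 fun a ha b hb => ?_
    simp only [Finset.mem_filter, Finset.mem_univ, true_and, one_smul] at ha hb
    rw [ha, hb]
  | succ j ih =>
    -- doubling maps the `2^(j+1)`-torsion to the `2^j`-torsion with fibres of size `≤ 2`
    set S := Finset.univ.filter fun b : B => 2 ^ (j + 1) • b = 0 with hS
    have himg : (S.image fun b : B => 2 • b) ⊆ Finset.univ.filter fun b : B => 2 ^ j • b = 0 := by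
      intro a ha
      obtain ⟨b, hb, rfl⟩ := Finset.mem_image.1 ha
      simp only [hS, Finset.mem_filter, Finset.mem_univ, true_and] at hb ⊢
      rw [← mul_nsmul', ← pow_succ]
      exact hb
    have hfib : ∀ a ∈ S.image (fun b : B => 2 • b), (S.filter fun b : B => 2 • b = a).card ≤ 2 := by
      intro a ha
      obtain ⟨b₀, -, rfl⟩ := Finset.mem_image.1 ha
      refine le_trans (Finset.card_le_card_of_injOn (fun b => b - b₀) (fun b hb => ?_) ?_) h2
      · simp only [Finset.coe_filter, Finset.mem_univ, true_and, Set.mem_setOf_eq] at hb ⊢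
        rw [smul_sub, hb.2, sub_self]
      · intro b _ b' _ h
        exact sub_left_injective h
    calc S.card ≤ 2 * (S.image fun b : B => 2 • b).card := Finset.card_le_mul_card_image _ _ hfib
      _ ≤ 2 * (Finset.univ.filter fun b : B => 2 ^ j • b = 0).card :=
        Nat.mul_le_mul_left _ (Finset.card_le_card himg)
      _ ≤ 2 * 2 ^ j := Nat.mul_le_mul_left _ ih
      _ = 2 ^ (j + 1) := by rw [pow_succ, mul_comm]

/-- **A finite abelian group of `2`-power order with at most two solutions of `2x = 0` is cyclic.** [folklore] -/
theorem isAddCyclic_of_card_filter_two_nsmul_le_two {m : ℕ} (hB : Fintype.card B = 2 ^ m)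
    (h2 : (Finset.univ.filter fun b : B => 2 • b = 0).card ≤ 2) : IsAddCyclic B := by
  apply isAddCyclic_of_card_nsmul_eq_zero_le
  intro n hn
  -- `n • b = 0 ↔ gcd(n, 2^m) • b = 0`, and `gcd(n, 2^m) = 2^j ≤ n`
  obtain ⟨j, -, hj⟩ := (Nat.dvd_prime_pow Nat.prime_two).1 (Nat.gcd_dvd_right n (2 ^ m))
  have hiff : ∀ b : B, n • b = 0 ↔ 2 ^ j • b = 0 := by
    intro b
    rw [← addOrderOf_dvd_iff_nsmul_eq_zero, ← addOrderOf_dvd_iff_nsmul_eq_zero, ← hj, Nat.dvd_gcd_iff,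
      iff_self_and]
    intro _
    rw [← hB]
    exact addOrderOf_dvd_card
  have hle : 2 ^ j ≤ n := by rw [← hj]; exact Nat.gcd_le_left _ hn
  calc (Finset.univ.filter fun b : B => n • b = 0).card
      = (Finset.univ.filter fun b : B => 2 ^ j • b = 0).card := by
        congr 1; ext b; simp only [Finset.mem_filter, Finset.mem_univ, true_and, hiff]
    _ ≤ 2 ^ j := card_filter_pow_nsmul_le h2 j
    _ ≤ n := hle

end Cyclic

/-! ## The thin case -/

section Thin

variable {A : Type*} [AddCommGroup A] [Fintype A] [DecidableEq A]

/-- **Thin case.**  `|A| = 2^{n+1}`, `c = 2u` a double, every involution among the doubles equal to `0` or `c`,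
and at most `4` solutions of `2x = 0`: then there is `z ∈ A` with `c ∈ ℤ z` and `|A| ≤ 2·ord(z)` (the doubles `2A`
form a cyclic group — at most two involutions — generated by some `2z`; `ord(z) = 2·|2A|` and
`|A| ≤ |A[2]|·|2A| ≤ 4·|2A|`). [folklore] -/
theorem exists_generator_of_thin {n : ℕ} (hA : Fintype.card A = 2 ^ (n + 1)) (c : A) (hc0 : c ≠ 0)
    (hcsq : ∃ u : A, 2 • u = c) (hW : ∀ v : A, 4 • v = 0 → 2 • v = 0 ∨ 2 • v = c)
    (hI : (Finset.univ.filter fun x : A => 2 • x = 0).card ≤ 4) :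
    ∃ z : A, (∃ k : ℤ, k • z = c) ∧ Fintype.card A ≤ 2 * addOrderOf z := by
  -- the doubling map and its range `B = 2A`
  set D : A →+ A := AddMonoidHom.mk' (fun x : A => 2 • x) (fun x y => smul_add 2 x y) with hD
  have hDapp : ∀ x, D x = 2 • x := fun x => rfl
  set B : AddSubgroup A := D.range with hB
  have hmemB : ∀ x, x ∈ B ↔ ∃ v, 2 • v = x := fun x => by rw [hB, AddMonoidHom.mem_range]; rfl
  -- `|B|` is a power of `2`
  have hBdvd : Nat.card B ∣ 2 ^ (n + 1) := by
    rw [← hA, ← Nat.card_eq_fintype_card]; exact AddSubgroup.card_addSubgroup_dvd_card B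
  obtain ⟨m, -, hBm⟩ := (Nat.dvd_prime_pow Nat.prime_two).1 hBdvd
  have hBcard : Fintype.card B = 2 ^ m := by rw [← Nat.card_eq_fintype_card, hBm]
  -- `B` has at most two solutions of `2b = 0`: they lie over `{0, c}`
  have hB2 : (Finset.univ.filter fun b : B => 2 • b = 0).card ≤ 2 := by
    refine le_trans (Finset.card_le_card_of_injOn (fun b : B => (b : A)) (fun b hb => ?_)
      (fun b _ b' _ h => Subtype.ext h)) (Finset.card_le_two (a := (0 : A)) (b := c))
    simp only [Finset.coe_filter, Finset.mem_univ, true_and, Set.mem_setOf_eq] at hb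
    obtain ⟨v, hv⟩ := (hmemB b).1 b.2
    have h4 : 4 • v = 0 := by
      rw [show (4 : ℕ) = 2 * 2 from rfl, mul_nsmul', hv, ← AddSubgroup.coe_nsmul, hb, AddSubgroup.coe_zero]
    simp only [Finset.coe_insert, Finset.coe_singleton, Set.mem_insert_iff, Set.mem_singleton_iff]
    rcases hW v h4 with h | h
    · left; rw [← hv, h]
    · right; rw [← hv, h]
  -- hence cyclic, generated by some `y = 2z`
  haveI := isAddCyclic_of_card_filter_two_nsmul_le_two hBcard hB2
  obtain ⟨y, hy⟩ := IsAddCyclic.exists_generator (α := B)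
  have hoy : addOrderOf (y : A) = Nat.card B := by
    rw [AddSubgroup.addOrderOf_coe, addOrderOf_eq_card_of_forall_mem_zmultiples hy]
  obtain ⟨z, hz⟩ := (hmemB y).1 y.2
  -- `c ∈ B = ℤ y`
  have hcB : c ∈ B := (hmemB c).2 hcsq
  obtain ⟨k, hk⟩ := AddSubgroup.mem_zmultiples_iff.1 (hy ⟨c, hcB⟩)
  have hkc : k • (y : A) = c := by
    have := congrArg (fun b : B => (b : A)) hk
    simpa only [AddSubgroup.coe_zsmul] using this
  -- `y ≠ 0` since `c ≠ 0`, so `ord(z)` is even and `ord(z) = 2 ord(2z)`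
  have hy0 : (y : A) ≠ 0 := fun h => hc0 (by rw [← hkc, h, smul_zero])
  have hz0 : z ≠ 0 := fun h => hy0 (by rw [← hz, h, smul_zero])
  have hzdvd : addOrderOf z ∣ 2 ^ (n + 1) := by rw [← hA]; exact addOrderOf_dvd_card
  obtain ⟨i, -, hi⟩ := (Nat.dvd_prime_pow Nat.prime_two).1 hzdvd
  have hi0 : i ≠ 0 := by
    rintro rfl
    rw [pow_zero, AddMonoid.addOrderOf_eq_one_iff] at hi
    exact hz0 hi
  have h2dvd : 2 ∣ addOrderOf z := by
    rw [hi]; exact dvd_pow_self 2 hi0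
  have hoz : addOrderOf (2 • z) = addOrderOf z / 2 := addOrderOf_nsmul_of_dvd two_ne_zero h2dvd
  refine ⟨z, ⟨k * 2, by rw [mul_zsmul, two_zsmul, ← two_nsmul, hz, hkc]⟩, ?_⟩
  -- `|A| ≤ |A[2]| · |2A| ≤ 4 · |B| = 2 · (2 |B|) = 2 · ord z`
  have hH : ∀ x : A, x ∈ (Finset.univ.image fun x : A => 2 • x) ↔ x ∈ B := fun x => by
    rw [hmemB]; simp only [Finset.mem_image, Finset.mem_univ, true_and]
  have himage : (Finset.univ.image fun x : A => 2 • x).card = Nat.card B := by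
    rw [Nat.card_eq_fintype_card, Fintype.card_of_subtype _ hH]
  have hcount := card_le_card_filter_mul_card_image (A := A)
  rw [himage] at hcount
  have hordz : addOrderOf z = 2 * Nat.card B := by
    rw [← hoy, ← hz, hoz, Nat.mul_div_cancel' h2dvd]
  calc Fintype.card A ≤ (Finset.univ.filter fun x : A => 2 • x = 0).card * Nat.card B := hcount
    _ ≤ 4 * Nat.card B := Nat.mul_le_mul_right _ hI
    _ = 2 * addOrderOf z := by rw [hordz]; ring

end Thin

end Summit.HodgeConjecture.CorCM.TwoGroupPieces
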